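import Literature.Computability.Complexity.ListBricks
import Literature.Computability.Complexity.FoldBricks
import Literature.NumberTheory.Primality.AKSPolyArith
import HarnessLib

/-!
# The AKS machine, I: multiplication in `ℤ_n[X]/(X^r - 1)` as an `FP` string function

First of the files realising the AKS primality test (`Literature.NumberTheory.Primality.AKS.aksDecide`,
[AKS04, §4]) as a polynomial-time string function, towards `PRIMES ∈ P`
(`Literature.Computability.QuantumComplexity.PRIMES_mem_P`, [AKS04, Thm 5.1]). As for the LLL machine
(`Algebra/EuclideanLattices/LLLMachineTables.lean`), no Turing machine is written by hand: every
routine is a composition of the tree's total `FP` string functions (`BrickAlgebra.lean`,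
`FoldBricks.lean`, `ListBricks.lean`, `StackBricksArith.lean`), whose membership in `FP` is by
composition lemmas, whose value on genuine codes is an `_apply` lemma, and whose output length is
bounded on every input in the shape the loop lemmas need.

* `natList l` — the code of a list of naturals (`encList` of the binary numerals); records
  `⟨ctx, ⟨u, v⟩⟩` with the **context** `ctx = ⟨pad, ⟨bin n, bin r⟩⟩`, where `pad` is a padding
  string (the yardstick making all genuine intermediate data linear in the record length);
* `pieceKI`, `sumFn` — the inner sum `∑_{i<r} u[i] · v[(k + r - i) mod r]` as a fold of `addFn`
  over the index `i` (`FoldBricks.foldLoop`, `foldAcc_addFn`), entries read by `ListBricks.nthLF`;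
* `pieceK`, **`cmulFn`** — the coefficient list of the product, `k < r`, as a fold of `appF`
  (clipped piece, `foldAcc_clipF`): `cmulFn ⟨ctx, ⟨natList u, natList v⟩⟩ = natList (AKS.cmul n r u v)`
  (`cmulFn_apply`, for `0 < n` and `r ≤ |ctx|`) and `cmulFn_mem_FP`.

## References

* [AKS04] M. Agrawal, N. Kayal, N. Saxena, *PRIMES is in P*, Ann. of Math. 160 (2004) 781–793,
  §5 (proof of Thm 5.1: "`O(log n)` multiplications of degree `r` polynomials with coefficients
  of size `O(log n)`").
* S. Arora, B. Barak, *Computational Complexity: A Modern Approach*, CUP 2009, §1.3 (polynomial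
  time is closed under composition and bounded loops).
-/

namespace Literature.Computability.QuantumComplexity

open _root_.Computability Complexity Complexity.Brick Polynomial
open Literature.NumberTheory.Primality

namespace AKSMachine

/-! ### Codes of lists of naturals -/

/-- The code of a list of natural numbers: the nested-pair list of their binary numerals.
[folklore] -/
def natList (l : List ℕ) : List Bool := encList (l.map encodeNat)

/-- `natList [] = []`. [folklore] -/
@[simp] theorem natList_nil : natList [] = [] := rfl

/-- `natList (a :: l) = ⟨bin a, natList l⟩`. [folklore] -/
theorem natList_cons (a : ℕ) (l : List ℕ) : natList (a :: l) = boolPair (encodeNat a) (natList l) := rfl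

/-- Reading entry `k` of a coded list of naturals (`k ≤ |x|`): the numeral of `l[k]`, `0` past
the end. [folklore] -/
theorem nthLF_natList (x : List Bool) {k : ℕ} (hk : k ≤ x.length) (l : List ℕ) :
    nthLF (boolPair x (boolPair (encodeNat k) (natList l))) = encodeNat (l.getD k 0) := by
  rw [natList, nthLF_apply x hk, show ([] : List Bool) = encodeNat 0 from rfl, List.getD_map]

/-- `|bin m| ≤ B` for `m < 2 ^ B`. [folklore] -/
theorem length_encodeNat_le_of_lt {m B : ℕ} (h : m < 2 ^ B) : (encodeNat m).length ≤ B := by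
  rw [TM2Pass.length_encodeNat_eq_size]; exact Nat.size_le.mpr h

/-- **Size of a coded list of naturals** with entries `< 2 ^ B`: `|natList l| ≤ |l| (2B + 2)`. [folklore] -/
theorem length_natList_le {l : List ℕ} {B : ℕ} (h : ∀ x ∈ l, x < 2 ^ B) :
    (natList l).length ≤ l.length * (2 * B + 2) := by
  induction l with
  | nil => simp
  | cons a l ih =>
    rw [natList_cons, length_boolPair, List.length_cons, add_mul, one_mul]
    have ha := length_encodeNat_le_of_lt (h a (by simp))
    have hl := ih (fun x hx => h x (by simp [hx]))
    omega

/-- `natList` is injective. [folklore] -/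
theorem natList_injective : Function.Injective natList := by
  intro l₁
  induction l₁ with
  | nil =>
    intro l₂ h
    cases l₂ with
    | nil => rfl
    | cons b l => exact absurd h (by simp [natList_cons, boolPair])
  | cons a l ih =>
    intro l₂ h
    cases l₂ with
    | nil => exact absurd h (by simp [natList_cons, boolPair])
    | cons b l' =>
      rw [natList_cons, natList_cons] at h
      have h1 := congrArg boolUnpair h
      rw [boolUnpair_boolPair, boolUnpair_boolPair, Prod.mk.injEq] at h1
      rw [show a = b by simpa using congrArg bitsToNat h1.1, ih h1.2]

/-- `⟨a, y⟩ ++ s = ⟨a, y ++ s⟩` (the pair code is a prefix code of `a` followed by `y`). [folklore] -/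
theorem boolPair_append (a y s : List Bool) : boolPair a y ++ s = boolPair a (y ++ s) := by
  simp [boolPair, List.append_assoc]

/-- `ccat` only depends on the pieces below the count. [folklore] -/
theorem ccat_congr {g g' : ℕ → List Bool} : ∀ {m : ℕ}, (∀ k < m, g k = g' k) → ccat g m = ccat g' m
  | 0, _ => rfl
  | m + 1, h => by rw [ccat_succ, ccat_succ, h m (Nat.lt_succ_self m), ccat_congr fun k hk => h k (by omega)]

/-- `natList (l ++ [a]) = natList l ++ ⟨bin a, ε⟩`. [folklore] -/
theorem natList_append_singleton (l : List ℕ) (a : ℕ) :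
    natList (l ++ [a]) = natList l ++ boolPair (encodeNat a) [] := by
  induction l with
  | nil => simp [natList_cons]
  | cons b l ih => rw [List.cons_append, natList_cons, natList_cons, ih, boolPair_append]

/-- A code of naturals is the `ccat` of the one-item codes `⟨bin l[k], ε⟩`. [folklore] -/
theorem natList_eq_ccat (l : List ℕ) :
    natList l = ccat (fun k => boolPair (encodeNat (l.getD k 0)) []) l.length := by
  induction l using List.reverseRecOn with
  | nil => simp
  | append_singleton l a ih =>
    rw [List.length_append, List.length_singleton, ccat_succ, natList_append_singleton,
      List.getD_append_right _ _ _ _ le_rfl, Nat.sub_self, List.getD_cons_zero, ih]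
    congr 1
    exact ccat_congr fun k hk => by rw [List.getD_append _ _ _ _ hk]

/-! ### The context record and the argument projections -/

/-- The context of the polynomial arithmetic: `⟨pad, ⟨bin n, bin r⟩⟩`. [folklore] -/
def pctx (pad : List Bool) (n r : ℕ) : List Bool := boolPair pad (boolPair (encodeNat n) (encodeNat r))

/-- The modulus field of a context. [folklore] -/
noncomputable def cN : List Bool → List Bool := nthF 1

/-- The order field of a context. [folklore] -/
noncomputable def cR : List Bool → List Bool := sndPow 1

/-- `cN_pctx` (auxiliary; see the module docstring). [folklore] -/
@[simp] theorem cN_pctx (pad : List Bool) (n r : ℕ) : cN (pctx pad n r) = encodeNat n := by simp [cN, pctx]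

/-- `cR_pctx` (auxiliary; see the module docstring). [folklore] -/
@[simp] theorem cR_pctx (pad : List Bool) (n r : ℕ) : cR (pctx pad n r) = encodeNat r := by simp [cR, pctx]

/-- The context is at least as long as the padding and the two numerals. [folklore] -/
theorem length_pctx (pad : List Bool) (n r : ℕ) :
    (pctx pad n r).length = 2 * pad.length + 2 * (encodeNat n).length + (encodeNat r).length + 4 := by
  simp [pctx, length_boolPair]; ring

/-- `cN` is in `FP` (composition of bricks). [folklore] -/
theorem cN_mem_FP : cN ∈ FP := nthF_mem_FP 1

/-- `cR` is in `FP` (composition of bricks). [folklore] -/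
theorem cR_mem_FP : cR ∈ FP := sndPow_mem_FP 1

/-! ### The inner sum `∑_{i<r} u[i] · v[(k + r - i) mod r]` -/

/-- On the inner argument `w = ⟨⟨X, 1ᵏ⟩, 1ⁱ⟩`: the record `X = ⟨ctx, ⟨u, v⟩⟩`. [folklore] -/
noncomputable def kiX : List Bool → List Bool := fstF ∘ fstF
/-- On the inner argument: `bin k`. [folklore] -/
noncomputable def kiK : List Bool → List Bool := lenBinF ∘ sndF ∘ fstF
/-- On the inner argument: `bin i`. [folklore] -/
noncomputable def kiI : List Bool → List Bool := lenBinF ∘ sndF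
/-- On the inner argument: `bin r` (from the context inside `X`). [folklore] -/
noncomputable def kiR : List Bool → List Bool := cR ∘ nthF 0 ∘ kiX
/-- On the inner argument: `bin ((k + r - i) mod r)`. [folklore] -/
noncomputable def kiJ : List Bool → List Bool :=
  remFn ∘ fanoutFn (subFn ∘ fanoutFn (addFn ∘ fanoutFn kiK kiR) kiI) kiR
/-- On the inner argument: the entry `u[i]` (yardstick `X`). [folklore] -/
noncomputable def kiUi : List Bool → List Bool := nthLF ∘ fanoutFn kiX (fanoutFn kiI (nthF 1 ∘ kiX))
/-- On the inner argument: the entry `v[(k + r - i) mod r]` (yardstick `X`). [folklore] -/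
noncomputable def kiVj : List Bool → List Bool := nthLF ∘ fanoutFn kiX (fanoutFn kiJ (sndPow 1 ∘ kiX))

/-- **The inner piece** `⟨⟨X, 1ᵏ⟩, 1ⁱ⟩ ↦ bin (u[i] · v[(k + r - i) mod r])`.
[cite: AgrawalKayalSaxena2004, §5 (proof of Thm 5.1)] -/
noncomputable def pieceKI : List Bool → List Bool := prodFn ∘ fanoutFn kiUi kiVj

/-- `kiX` is in `FP` (composition of bricks). [folklore] -/
theorem kiX_mem_FP : kiX ∈ FP := comp_mem_FP fstF_mem_FP fstF_mem_FP
/-- `kiK` is in `FP` (composition of bricks). [folklore] -/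
theorem kiK_mem_FP : kiK ∈ FP := comp_mem_FP lenBinF_mem_FP (comp_mem_FP sndF_mem_FP fstF_mem_FP)
/-- `kiI` is in `FP` (composition of bricks). [folklore] -/
theorem kiI_mem_FP : kiI ∈ FP := comp_mem_FP lenBinF_mem_FP sndF_mem_FP
/-- `kiR` is in `FP` (composition of bricks). [folklore] -/
theorem kiR_mem_FP : kiR ∈ FP := comp_mem_FP cR_mem_FP (comp_mem_FP (nthF_mem_FP 0) kiX_mem_FP)
/-- `kiJ` is in `FP` (composition of bricks). [folklore] -/
theorem kiJ_mem_FP : kiJ ∈ FP :=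
  comp_mem_FP remFn_mem_FP (fanoutFn_mem_FP
    (comp_mem_FP subFn_mem_FP (fanoutFn_mem_FP (comp_mem_FP addFn_mem_FP (fanoutFn_mem_FP kiK_mem_FP kiR_mem_FP))
      kiI_mem_FP)) kiR_mem_FP)
/-- `kiUi` is in `FP` (composition of bricks). [folklore] -/
theorem kiUi_mem_FP : kiUi ∈ FP :=
  comp_mem_FP nthLF_mem_FP (fanoutFn_mem_FP kiX_mem_FP (fanoutFn_mem_FP kiI_mem_FP (comp_mem_FP (nthF_mem_FP 1) kiX_mem_FP)))
/-- `kiVj` is in `FP` (composition of bricks). [folklore] -/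
theorem kiVj_mem_FP : kiVj ∈ FP :=
  comp_mem_FP nthLF_mem_FP (fanoutFn_mem_FP kiX_mem_FP (fanoutFn_mem_FP kiJ_mem_FP (comp_mem_FP (sndPow_mem_FP 1) kiX_mem_FP)))

/-- `pieceKI ∈ FP`. [folklore] -/
theorem pieceKI_mem_FP : pieceKI ∈ FP := comp_mem_FP prodFn_mem_FP (fanoutFn_mem_FP kiUi_mem_FP kiVj_mem_FP)

/-- **Growth of the inner piece**, on every input: two entries of lists inside the first field,
so `|pieceKI w| ≤ 2 (|fstF w| + 1)`. [folklore] -/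
theorem length_pieceKI_le (w : List Bool) : (pieceKI w).length ≤ 2 * ((fstF w).length + 1) := by
  have hX : (kiX w).length ≤ (fstF w).length := by
    have := length_fstF_sndF_le (fstF w); simp [kiX]; omega
  have hu : (kiUi w).length ≤ (kiX w).length := by
    rw [kiUi, Function.comp_apply]
    refine (length_nthLF_le _).trans ?_
    rw [fanoutFn_apply, fanoutFn_apply, show sndPow 1 = sndF ∘ sndF from rfl, Function.comp_apply, sndF_boolPair,
      sndF_boolPair, Function.comp_apply]
    exact length_nthF_le 1 _
  have hv : (kiVj w).length ≤ (kiX w).length := by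
    rw [kiVj, Function.comp_apply]
    refine (length_nthLF_le _).trans ?_
    rw [fanoutFn_apply, fanoutFn_apply, show sndPow 1 = sndF ∘ sndF from rfl, Function.comp_apply, sndF_boolPair,
      sndF_boolPair, Function.comp_apply]
    exact length_sndPow_le 1 _
  have hp := length_prodFn_le (boolPair (kiUi w) (kiVj w))
  rw [fstF_boolPair, sndF_boolPair] at hp
  rw [pieceKI, Function.comp_apply, fanoutFn_apply]
  omega

/-- **Value of the inner piece** on a genuine argument: with `X = ⟨pctx pad n r, ⟨natList u, natList v⟩⟩`,
`i ≤ |X|` and `(k + r - i) mod r ≤ |X|`, it is `bin (u[i] · v[(k + r - i) mod r])`. [folklore] -/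
theorem pieceKI_apply (pad : List Bool) (n r : ℕ) (u v : List ℕ) (k i : ℕ)
    (hi : i ≤ (boolPair (pctx pad n r) (boolPair (natList u) (natList v))).length)
    (hj : (k + r - i) % r ≤ (boolPair (pctx pad n r) (boolPair (natList u) (natList v))).length) :
    pieceKI (boolPair (boolPair (boolPair (pctx pad n r) (boolPair (natList u) (natList v))) (ones k)) (ones i)) =
      encodeNat (u.getD i 0 * v.getD ((k + r - i) % r) 0) := by
  simp only [pieceKI, kiUi, kiVj, kiJ, kiK, kiI, kiR, kiX, Function.comp_apply, fanoutFn_apply, fstF_boolPair,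
    sndF_boolPair, lenBinF_apply, List.length_replicate, nthF_zero_boolPair, nthF_succ_boolPair, cR_pctx,
    addFn_boolPair, subFn_boolPair, remFn_boolPair, bitsToNat_encodeNat]
  rw [show sndPow 1 = sndF ∘ sndF from rfl, Function.comp_apply, sndF_boolPair, sndF_boolPair,
    nthLF_natList _ hi, nthLF_natList _ hj, prodFn_boolPair, bitsToNat_encodeNat, bitsToNat_encodeNat]

/-- The initial record of the inner sum on `w' = ⟨X, 1ᵏ⟩`: `⟨w', ⟨bin r, ⟨1⁰, bin 0⟩⟩⟩`. [folklore] -/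
noncomputable def sumInit : List Bool → List Bool :=
  fanoutFn id (fanoutFn (cR ∘ nthF 0 ∘ fstF) fun _ => boolPair [] [])

/-- **The inner sum** `⟨X, 1ᵏ⟩ ↦ bin (∑_{i<r} u[i] · v[(k + r - i) mod r])`: `r` rounds of the `addFn`-fold
of `pieceKI`. [cite: AgrawalKayalSaxena2004, §5 (proof of Thm 5.1)] -/
noncomputable def sumFn : List Bool → List Bool := sndPow 2 ∘ foldLoop addFn pieceKI X ∘ sumInit

/-- `sumFn ∈ FP`. [folklore] -/
theorem sumFn_mem_FP : sumFn ∈ FP :=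
  comp_mem_FP (sndPow_mem_FP 2) (comp_mem_FP
    (foldLoop_mem_FP addFn_mem_FP length_addFn_le pieceKI_mem_FP (C := 2) length_pieceKI_le X)
    (fanoutFn_mem_FP OracleCompose.id_mem_FP
      (fanoutFn_mem_FP (comp_mem_FP cR_mem_FP (comp_mem_FP (nthF_mem_FP 0) fstF_mem_FP)) (const_mem_FP _))))

/-- **Value of the inner sum** (`r ≤ |ctx|`): `bin (∑_{i<r} u[i] · v[(k + r - i) mod r])`. [folklore] -/
theorem sumFn_apply (pad : List Bool) {n r : ℕ} (hr : r ≤ (pctx pad n r).length) (u v : List ℕ) (k : ℕ) :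
    sumFn (boolPair (boolPair (pctx pad n r) (boolPair (natList u) (natList v))) (ones k)) =
      encodeNat (∑ i ∈ Finset.range r, u.getD i 0 * v.getD ((k + r - i) % r) 0) := by
  have hlen : (pctx pad n r).length ≤ (boolPair (pctx pad n r) (boolPair (natList u) (natList v))).length := by
    rw [length_boolPair]; omega
  have hinit : sumInit (boolPair (boolPair (pctx pad n r) (boolPair (natList u) (natList v))) (ones k)) =
      boolPair (boolPair (boolPair (pctx pad n r) (boolPair (natList u) (natList v))) (ones k))
        (boolPair (encodeNat r) (boolPair (ones 0) (encodeNat 0))) := by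
    rw [show (ones 0 : List Bool) = [] from rfl, show encodeNat 0 = [] from rfl]; simp [sumInit]
  rw [sumFn, Function.comp_apply, Function.comp_apply, hinit,
    foldLoop_apply addFn pieceKI (by rw [eval_X, length_boolPair]; omega) 0 (encodeNat 0)]
  rw [show sndPow 2 = sndF ∘ sndF ∘ sndF from rfl]
  simp only [Function.comp_apply, sndF_boolPair]
  rw [foldAcc_addFn, zero_add]
  apply congrArg encodeNat
  refine Finset.sum_congr rfl fun i hi => ?_
  have hi' := Finset.mem_range.mp hi
  have hjr : (k + r - i) % r < r := Nat.mod_lt _ (by omega)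
  rw [zero_add, pieceKI_apply pad n r u v k i (by omega) (by omega), bitsToNat_encodeNat]

/-! ### The product, coefficient by coefficient -/

/-- **The piece of the product**: `⟨X, 1ᵏ⟩ ↦ ⟨bin ((∑_{i<r} u[i] v[(k + r - i) mod r]) mod n), ε⟩`, the
one-item code of coefficient `k` of `u ⋆ v`. [cite: AgrawalKayalSaxena2004, §5 (proof of Thm 5.1)] -/
noncomputable def pieceK : List Bool → List Bool :=
  fanoutFn (remFn ∘ fanoutFn sumFn (cN ∘ nthF 0 ∘ fstF)) fun _ => []

/-- `pieceK ∈ FP`. [folklore] -/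
theorem pieceK_mem_FP : pieceK ∈ FP :=
  fanoutFn_mem_FP (comp_mem_FP remFn_mem_FP (fanoutFn_mem_FP sumFn_mem_FP
    (comp_mem_FP cN_mem_FP (comp_mem_FP (nthF_mem_FP 0) fstF_mem_FP)))) (const_mem_FP _)

/-- **Value of the product piece** (`0 < n`, `r ≤ |ctx|`, `k < r`). [folklore] -/
theorem pieceK_apply (pad : List Bool) {n r : ℕ} (hr : r ≤ (pctx pad n r).length) (u v : List ℕ)
    {k : ℕ} (hk : k < r) :
    pieceK (boolPair (boolPair (pctx pad n r) (boolPair (natList u) (natList v))) (ones k)) =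
      boolPair (encodeNat ((AKS.cmul n r u v).getD k 0)) [] := by
  have hget : (AKS.cmul n r u v).getD k 0 = (∑ i ∈ Finset.range r, u.getD i 0 * v.getD ((k + r - i) % r) 0) % n := by
    rw [AKS.cmul, List.getD_eq_getElem _ _ (by simpa using hk)]
    simp
  simp only [pieceK, fanoutFn_apply, Function.comp_apply, fstF_boolPair, nthF_zero_boolPair, cN_pctx,
    sumFn_apply pad hr u v k, remFn_boolPair, bitsToNat_encodeNat, hget]

/-- The genuine product pieces are short: `≤ 2 (|X| + 1)` symbols. [folklore] -/
theorem length_pieceK_apply_le (pad : List Bool) {n r : ℕ} (hn : 0 < n) (hr : r ≤ (pctx pad n r).length)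
    (u v : List ℕ) {k : ℕ} (hk : k < r) :
    (pieceK (boolPair (boolPair (pctx pad n r) (boolPair (natList u) (natList v))) (ones k))).length ≤
      2 * ((boolPair (pctx pad n r) (boolPair (natList u) (natList v))).length + 1) := by
  have hk' : k < (AKS.cmul n r u v).length := by simpa using hk
  have hlt : (AKS.cmul n r u v).getD k 0 < n := by
    rw [List.getD_eq_getElem _ _ hk']
    exact (AKS.canon_cmul hn r u v).2 _ (List.getElem_mem hk')
  have h1 : (encodeNat ((AKS.cmul n r u v).getD k 0)).length ≤ (encodeNat n).length := length_encodeNat_mono hlt.le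
  have h2 : (encodeNat n).length ≤ (pctx pad n r).length := by rw [length_pctx]; omega
  rw [pieceK_apply pad hr u v hk, length_boolPair, List.length_nil, length_boolPair]
  omega

/-- The initial record of the product on `X`: `⟨X, ⟨bin r, ⟨1⁰, ε⟩⟩⟩`. [folklore] -/
noncomputable def cmulInit : List Bool → List Bool :=
  fanoutFn id (fanoutFn (cR ∘ nthF 0) fun _ => boolPair [] [])

/-- **Multiplication in `ℤ_n[X]/(X^r - 1)`** on coded coefficient lists: `r` rounds of the `appF`-fold
of the (clipped) product pieces. [cite: AgrawalKayalSaxena2004, §5 (proof of Thm 5.1)] -/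
noncomputable def cmulFn : List Bool → List Bool := sndPow 2 ∘ foldLoop appF (clipF 2 pieceK) X ∘ cmulInit

/-- **`cmulFn ∈ FP`.** [cite: AgrawalKayalSaxena2004, §5 (proof of Thm 5.1)] -/
theorem cmulFn_mem_FP : cmulFn ∈ FP :=
  comp_mem_FP (sndPow_mem_FP 2) (comp_mem_FP (foldLoop_clipF_mem_FP 2 appF_mem_FP length_appF_le pieceK_mem_FP X)
    (fanoutFn_mem_FP OracleCompose.id_mem_FP
      (fanoutFn_mem_FP (comp_mem_FP cR_mem_FP (nthF_mem_FP 0)) (const_mem_FP _))))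

/-- **`cmulFn` computes `AKS.cmul`**: for `0 < n` and `r ≤ |ctx|`,
`cmulFn ⟨ctx, ⟨natList u, natList v⟩⟩ = natList (cmul n r u v)`. [cite: AgrawalKayalSaxena2004, §5 (proof of Thm 5.1)] -/
theorem cmulFn_apply (pad : List Bool) {n r : ℕ} (hn : 0 < n) (hr : r ≤ (pctx pad n r).length) (u v : List ℕ) :
    cmulFn (boolPair (pctx pad n r) (boolPair (natList u) (natList v))) = natList (AKS.cmul n r u v) := by
  have hlen : (pctx pad n r).length ≤ (boolPair (pctx pad n r) (boolPair (natList u) (natList v))).length := by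
    rw [length_boolPair]; omega
  have hinit : cmulInit (boolPair (pctx pad n r) (boolPair (natList u) (natList v))) =
      boolPair (boolPair (pctx pad n r) (boolPair (natList u) (natList v)))
        (boolPair (encodeNat r) (boolPair (ones 0) [])) := by
    simp [cmulInit]
  rw [cmulFn, Function.comp_apply, Function.comp_apply, hinit,
    foldLoop_apply appF _ (by rw [eval_X]; omega) 0 []]
  rw [show sndPow 2 = sndF ∘ sndF ∘ sndF from rfl]
  simp only [Function.comp_apply, sndF_boolPair]
  rw [foldAcc_clipF (fun j _ hj => length_pieceK_apply_le pad hn hr u v (by omega)),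
    foldAcc_appF, List.nil_append, natList_eq_ccat (AKS.cmul n r u v), AKS.length_cmul]
  exact ccat_congr fun k hk => by rw [zero_add, pieceK_apply pad hr u v hk]

end AKSMachine

end Literature.Computability.QuantumComplexity
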